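import Mathlib
import Literature.MathematicalPhysics.QuantumFieldTheory.Balaban1983to89.B13Geometry236

/-!
# `Balaban1983to89.B13Geometry236Printed` — [Balaban1988RG2Cluster] p. 19, the scale-transfer inequality (2.36)
"2d_k(Z_i) ≧ Ld_{k+1}(Z′_i)" WITH THE PRINTED FACTOR 2, PROVED IN THE KERNEL for the formalised tree length `treeLen`
(sup metric), in every dimension d and for every block size L ≥ 8 — through the general constant 3/2 + 3/(L − 2), L ≥ 3

CITATION HEADER (lean-in-tree rule 2026-08-18).  Source under audit: T. Bałaban, *Renormalization group approach to
lattice gauge field theories. II. Cluster expansions*, Commun. Math. Phys. **116**, 1–22 (1988), doi:10.1007/bf01239022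
[Balaban1988RG2Cluster] (cell paper B13; PDF held `paper:balaban1988-cmp116-rg-ii-cluster`, journal page = PDF page;
the sentences of p. 19 repeated below are quoted — and were render-checked, render `…1988-cmp116-rg-II-cluster-p019-x2.png`,
cell GAPS C-pv23-4 / C-adv4-59 / C-pv11g2-1 — in the sibling modules `…Balaban1983to89.B13` Part F,
`…Balaban1983to89.B13ScaleTransfer` and `…Balaban1983to89.B13Geometry236`), together with the definitions of
[Balaban1987RG1] = part I, Commun. Math. Phys. **109** (1987) p. 257 (cubes, X̃, the linear size d_j) as formalised by
unit pv22 in `…Balaban1983to89.TreeLength` (`treeLen`: connected polygonal graphs in closed unit cubes, Mathlib's sup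
metric on ℝ^d = the convention of [Dimock2013BalabanII] App. E — part I names no metric: cell DIVERGENCE D-T2,
D-pv22.1).  Imports ONLY `…B13Geometry236` (unit pv11 gen 2: `snap`, `snap_mem_cube`, `exists_corner_point`,
`sub_two_le_len`, `exists_common_point`, `admissible_point`, `le_mul_treeLen`, `isConnected_union_carrier`,
`closureDom`, `a236`) and through it `…TreeLengthCubeSystem` / `…TreeLength` (pv22), `…B13ScaleTransfer` (pv11: the
index model `Pt`, `collar` = X̃, `closureIdx` = Z ↦ Z′, `ScaleTransfer`, `Ineq236Printed`) and `…B13` (b13: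
`Ineq236With`, `Ineq236Printed`, `Consts.aL`, `Consts.R22gen`); nothing existing is modified.  Unit
`b2b-balaban-b13-g13` (paper sub-cell B13, gen 13), journal claim G-B13-09-PRINTED-KERNEL.  CREDITS: the
whisker-at-the-CENTRE idea and the constant 3/2 + 3/(L − 2) are adversarial reader adv4 gen 31's (prose
`HOME/b2b-balaban-adv4/g31/B13-236-sharpened.md` §1 Lemma W / Theorem A′ / Corollary B′, cell GAPS C-adv4-59: "(2.36)
with factor exactly 2 is TRUE in the ℓ^∞ reading for every L ≥ 8"); the tree cutting is the prose
`HOME/b2b-balaban-b13/GEOMETRY-236.md` Theorem A (unit b13 gen 2, GAPS G-B13-09R); the frame — rescaling, corner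
points, the rounding map, "two scales apart", the limit in the free parameter — is `…B13Geometry236` (pv11 gen 2, GAPS
C-pv11g2-1).  This module supplies the kernel proofs of the tree facts (centre, spanning tree, cutting) and assembles them.

WHAT THE PAPER PRINTS (p. 19 [PDF 19], verbatim): *"The remaining exponential is bounded using the following
inequality: 2d_k(Z_i) ≧ Ld_{k+1}(Z′_i). (2.36) This inequality can be obtained by simple, but awkward, geometric and
combinatoric considerations. It follows by considering locally many possible cases."*, where (p. 19) *"we denote by
Z′_i the smallest localization domain from 𝐃_{k+1} containing Z̃_i"*.  In the index model (as in `…B13Geometry236`):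
Z ⊂ ℤ^d non-empty and face-connected (a localization domain from 𝐃_k, unit cubes), Z̃ = `collar Z`, Z′ = `closureIdx L
(collar Z)` (index set of the π_{k+1}-cubes met by Z̃, rescaled to unit cubes by p ↦ p/L), d_k = d_{k+1} = `treeLen`.

WHAT IS PROVED HERE (kernel-checked, zero `sorry`; every input is a theorem of the imported modules or of Mathlib; no
`def … : Prop` fact is introduced; every declaration is tagged [folklore] or [cite: …]).
`geometry236_centre`: for every d, every L ≥ 3 and every non-empty face-connected Z,
  L · treeLen(Z′) ≤ (3/2 + 3/(L − 2)) · treeLen(Z)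
(pv11's shape: `scaleTransfer_treeLen_centre : ScaleTransfer d L treeLen (a236c L) 0`, `a236c L` = 3/2 + 3/(L − 2)
< `B13Geometry236.a236 L` = 3 + 4/(L − 2) < `B13.Consts.aL L` = 3 + 12/(L − 2), `a236c_lt_a236`, `a236c_lt_aL`;
d = 4, L = 13: 13 · d_{k+1}(Z′) ≤ (39/22) · d_k(Z), `geometry236_centre_thirteen`; transfer factor 13/a236c 13 = 22/3
= 7.33… (`transferFactor_thirteen`) — LARGER than the printed ½L = 6.5; kernel predecessor 143/37 = 3.86…, prose 143/45).
`geometry236_printed` — (2.36) WITH THE PRINTED CONSTANT: for every d, every L ≥ 8 and every non-empty face-connected Z,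
  L · treeLen(Z′) ≤ 2 · treeLen(Z),   i.e.   ½L · d_{k+1}(Z′) ≤ d_k(Z),
since 3/2 + 3/(L − 2) ≤ 2 iff L ≥ 8 (`a236c_le_two_iff`); in pv11's shape `ineq236Printed_treeLen :
B13ScaleTransfer.Ineq236Printed d L treeLen` (the Prop typed "for the record, never used" in `…B13ScaleTransfer`
is a theorem for L ≥ 8); the exponential form of pp. 19–20 with the printed ½L (`exp_transfer_printed`).  Every L
admitted by [Balaban1987RG1] p. 251 (*"L is an odd, positive integer > 11"*) satisfies L ≥ 8.  Part 9 — THE WINDOW: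
for pv22's window systems `TreeLengthCubeSystem.sys B`, b13's `B13.Ineq236Printed (sys B_k) (sys B_{k+1}) (Z ↦ Z′) L`
= `B13.Ineq236With … (L/2)` is a THEOREM for every d and every L ≥ 8 (`ineq236Printed_window`,
`ineq236Printed_window_self`): the transfer input of `B13.exp_transfer_of_ineq236With` — the parameter ℓ of
`B13.Lemma3With`, `B13.Consts.R22gen`, `B13.deliverables_of_chainWith`, `B13Closing.deliverables_window`, all
parametric in ℓ — now holds on that carrier AT THE PRINTED ℓ = ½L, where `R22gen (L/2)` is literally the printed
"last assumption" R22 of p. 21, *"(1 − 10δ)½L = 1, or δ = (1/10)(1 − 2L⁻¹)"* (`B13.Consts.R22gen_half_iff`); the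
general-L form `ineq236With_window_centre` gives ℓ = L/a236c L for every L ≥ 3.

THE PROOF.  Fix an admissible graph T for Z and rescale it by 1/L (pv22's `admissible_scale`: an admissible graph T₁
for the π_{k+1}-cubes met by Z, |T₁| = |T|/L); fix 0 < ρ with 2ρ + 2 < L.  (1) ROOTED POLYGONAL TREES (Part 3, `RT`:
the binary first-child / rest-of-tree encoding; `root`, `len`, `carrier`, `reach` = height, `EdgeLe`).  (2) THE CENTRE
(Part 4, `RT.exists_centre`): a polygonal tree of total length w has a point m with every point of the tree within
(sup-)distance w/2 of m — from the deep-point lemma `RT.exists_deep_point` (the point at depth s on a deepest branch is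
within max(reach − s, s + len − reach) of every point), s = reach − w/2.  This ½ is what a separated net cannot give
(covering radius 2r against packing radius r, step (3) of `…B13Geometry236`) and is where the factor drops from 3 to
3/2.  (3) A SPANNING TREE (Parts 2, 5): subdivide the segments of T₁ into pieces of length ≤ ε (`subdiv`: same carrier,
same length) and grow a rooted tree with the same carrier and no larger total length by hanging one segment at a time
at a point where it meets the tree (`RT.exists_hang`, `RT.exists_RT`; the meeting point comes from connectedness in
the closed-sets form `isPreconnected_iff_subset_of_disjoint_closed`).  (4) CUTTING (Part 6, `RT.exists_cut`, bottom-up: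
a pending sub-tree is cut off as soon as its length reaches θ): pieces of length in [θ, 2θ + ε) and one stub of length
< θ, lengths adding up to the tree's, carriers covering it; with the centres of the pieces this is the CENTRE NET
`exists_centre_net` (Part 7; a statement about a connected polygonal graph only — no Z, no L, no cubes): points
m_i ∈ T₁ and weights 0 ≤ w_i < 2θ + ε, every point of T₁ within w_i/2 of some m_i, Σ w_i ≤ |T₁|, (N − 1)·θ ≤ |T₁|.
(5) WHISKERS (`exists_admissible_closure_centre`): θ = ρ/L and 2θ + ε = 1 − 2/L; hang at each m_i the segment to
`snap R_i m_i`, R_i = w_i/2 + 1/L, so that 2R_i < 1.  Every cell c of Z′ contains a point q within 1/L of the rescaled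
witness point of some cube of Z (`exists_corner_point`), that witness point lies on T₁, hence within w_i/2 of some m_i,
so q is within R_i of m_i and c ∋ snap R_i m_i (`snap_mem_cube` — the sup metric and 2R_i < 1); each whisker lies in a
cell containing m_i (convexity), and T₁ plus the whiskers is connected (`isConnected_union_carrier`): admissible for Z′.
(6) ACCOUNTING: L·|T′| ≤ |T| + L·Σ_i R_i = |T| + (L/2)·Σ w_i + N ≤ (3/2)|T| + N and N ≤ 1 + |T|/ρ.  If two cells of
Z′ are two scales apart then |T| ≥ L − 2 (`sub_two_le_len`) and 1 ≤ |T|/(L − 2); otherwise all cells of Z′ share a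
point and treeLen(Z′) = 0 (`exists_common_point`, `admissible_point`).  So L·treeLen(Z′) ≤ (3/2 + 1/(L − 2) + 1/ρ)·|T|
for every admissible T and every ρ < (L − 2)/2 (`le_mul_treeLen`), and ρ ↑ (L − 2)/2 (`le_of_forall_pos_le_add`) gives
3/2 + 3/(L − 2).

WHAT IS *NOT* CLAIMED.  (i) METRIC: only the sup-metric tree length `treeLen` is treated — the cell's fixed reading of
d_j (D-T2; [Dimock2013BalabanII] App. E).  In the Euclidean / ℓ¹ readings the centre bound w/2 becomes w/√2 + … /
(3/4)w + … and the printed factor is reached only for larger L (prose C-adv4-59: L ≥ 23 / L ≥ 50; Euclidean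
13 ≤ L ≤ 21 undecided there) — none of that is formalised here.  (ii) For 3 ≤ L ≤ 7 only `geometry236_centre` is
asserted: there 3/2 + 3/(L − 2) > 2, and the printed factor is false for small L (cell G-B13-09 (i): L = 3).
(iii) `treeLen` carries pv22's conventions D-pv22.1 (connected polygonal graphs rather than trees — same infimum —,
closed unit cubes, free boundary: no torus wrap-around).  The periodic twin (pv22's `…TreeLengthTorusGeometry236`,
factor a236) is NOT upgraded here; `exists_centre_net` is stated free of Z, L and the cubes so that it can be, with that
module's own lifts and corner points.  (iv) Nothing about Lemma 3, (2.37)–(2.41) or the series, and the paper's own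
"locally many possible cases" argument is not reconstructed: this is an independent elementary proof of the printed
inequality for the formalised carrier.  Value = kernel certificate (cell gap G-B13-09 closed AT THE PRINTED CONSTANT for
the formalised d_k and every admitted L), NOT summit progress.
-/

namespace Literature.MathematicalPhysics.QuantumFieldTheory.Balaban1983to89.B13Geometry236Printed

noncomputable section

open Literature.MathematicalPhysics.QuantumFieldTheory.Balaban1983to89
open Literature.MathematicalPhysics.QuantumFieldTheory.Balaban1983to89.B13ScaleTransfer
open Literature.MathematicalPhysics.QuantumFieldTheory.Balaban1983to89.TreeLength
open Literature.MathematicalPhysics.QuantumFieldTheory.Balaban1983to89.B13Geometry236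
open MeasureTheory

variable {d : ℕ}

/-! ## Part 1. Complements on segments (sup metric) and on pv22's polygonal graphs -/

/-- The distance from a point to a point of a segment is at most the larger of the distances to the endpoints
(closed balls are convex). [folklore] -/
theorem dist_le_max_of_mem_segment {x a b z : RPt d} (hz : z ∈ segment ℝ a b) :
    dist x z ≤ max (dist x a) (dist x b) := by
  have ha : a ∈ Metric.closedBall x (max (dist x a) (dist x b)) := by
    rw [Metric.mem_closedBall, dist_comm]
    exact le_max_left _ _
  have hb : b ∈ Metric.closedBall x (max (dist x a) (dist x b)) := by
    rw [Metric.mem_closedBall, dist_comm]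
    exact le_max_right _ _
  have h := (convex_closedBall x (max (dist x a) (dist x b))).segment_subset ha hb hz
  rw [Metric.mem_closedBall, dist_comm] at h
  exact h

/-- γ_s(0) = s₁. [folklore] -/
@[simp] theorem gam_zero (s : Seg d) : gam s 0 = s.1 := by
  simp [gam]

/-- γ_s(1) = s₂. [folklore] -/
@[simp] theorem gam_one (s : Seg d) : gam s 1 = s.2 := by
  simp [gam]

/-- γ_s(β) − γ_s(α) = (β − α)(s₂ − s₁). [folklore] -/
theorem gam_sub_gam (s : Seg d) (α β : ℝ) : gam s β - gam s α = (β - α) • (s.2 - s.1) := by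
  simp only [gam, sub_smul]
  abel

/-- |γ_s(α) − γ_s(β)| = |β − α| · |s₁ − s₂|. [folklore] -/
theorem dist_gam_gam (s : Seg d) (α β : ℝ) : dist (gam s α) (gam s β) = |β - α| * dist s.1 s.2 := by
  rw [dist_comm, dist_eq_norm, gam_sub_gam, norm_smul, Real.norm_eq_abs, dist_comm, dist_eq_norm]

/-- γ_s(t) ∈ [s₁, s₂] for t ∈ [0, 1]. [folklore] -/
theorem gam_mem_segment (s : Seg d) {t : ℝ} (h0 : 0 ≤ t) (h1 : t ≤ 1) : gam s t ∈ segment ℝ s.1 s.2 := by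
  rw [segment_eq_image_gam]
  exact ⟨t, ⟨h0, h1⟩, rfl⟩

/-- Sub-segments along the parametrisation: for α ≤ t ≤ β, γ_s(t) ∈ [γ_s(α), γ_s(β)]. [folklore] -/
theorem gam_mem_segment_gam (s : Seg d) {α β t : ℝ} (h1 : α ≤ t) (h2 : t ≤ β) :
    gam s t ∈ segment ℝ (gam s α) (gam s β) := by
  rcases (h1.trans h2).eq_or_lt with hαβ | hαβ
  · have ht : t = α := le_antisymm (hαβ ▸ h2) h1
    rw [ht]
    exact left_mem_segment ℝ _ _
  · rw [segment_eq_image' ℝ]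
    refine ⟨(t - α) / (β - α), ⟨div_nonneg (by linarith) (by linarith), ?_⟩, ?_⟩
    · rw [div_le_one (by linarith)]
      linarith
    · show gam s α + ((t - α) / (β - α)) • (gam s β - gam s α) = gam s t
      rw [gam_sub_gam, smul_smul, div_mul_cancel₀ _ (by linarith : β - α ≠ 0)]
      simp only [gam, sub_smul]
      abel

/-- A point m of a segment [a, b] splits it: [a, b] ⊆ [a, m] ∪ [m, b]. [folklore] -/
theorem segment_subset_union {a b m : RPt d} (hm : m ∈ segment ℝ a b) :
    segment ℝ a b ⊆ segment ℝ a m ∪ segment ℝ m b := by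
  intro z hz
  have hm' : m ∈ segment ℝ (a, b).1 (a, b).2 := hm
  have hz' : z ∈ segment ℝ (a, b).1 (a, b).2 := hz
  rw [segment_eq_image_gam] at hm' hz'
  obtain ⟨σ, ⟨hσ0, hσ1⟩, hσ⟩ := hm'
  obtain ⟨t, ⟨ht0, ht1⟩, ht⟩ := hz'
  rw [← hσ, ← ht]
  rcases le_total t σ with h | h
  · left
    have := gam_mem_segment_gam (a, b) ht0 h
    rwa [gam_zero] at this
  · right
    have := gam_mem_segment_gam (a, b) h ht1
    rwa [gam_one] at this

/-- The two halves of a split segment lie in the segment. [folklore] -/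
theorem segment_union_eq_of_mem {a b m : RPt d} (hm : m ∈ segment ℝ a b) :
    segment ℝ m a ∪ segment ℝ m b = segment ℝ a b := by
  apply Set.Subset.antisymm
  · exact Set.union_subset ((convex_segment _ _).segment_subset hm (left_mem_segment ℝ _ _))
      ((convex_segment _ _).segment_subset hm (right_mem_segment ℝ _ _))
  · rw [segment_symm ℝ m a]
    exact segment_subset_union hm

/-- The carrier of a graph is the union of its segments, indexed by the finite set of its segments. [folklore] -/
theorem carrier_eq_biUnion [DecidableEq (Seg d)] (T : List (Seg d)) :
    carrier T = ⋃ s ∈ T.toFinset, segment ℝ s.1 s.2 := by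
  ext z
  rw [mem_carrier, Set.mem_iUnion₂]
  simp only [List.mem_toFinset, exists_prop]

/-- Every segment of a graph is no longer than the graph. [folklore] -/
theorem dist_le_len_of_mem {T : List (Seg d)} {s : Seg d} (hs : s ∈ T) : dist s.1 s.2 ≤ len T := by
  induction T with
  | nil => simp at hs
  | cons s' T ih =>
    rw [len_cons]
    rcases List.mem_cons.1 hs with rfl | h
    · linarith [len_nonneg T]
    · linarith [ih h, (dist_nonneg : 0 ≤ dist s'.1 s'.2)]

/-- The total length of the distinct segments of a graph is at most its length. [folklore] -/
theorem sum_toFinset_le_len [DecidableEq (Seg d)] (T : List (Seg d)) :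
    ∑ s ∈ T.toFinset, dist s.1 s.2 ≤ len T := by
  induction T with
  | nil => simp
  | cons s T ih =>
    rw [List.toFinset_cons, len_cons]
    by_cases h : s ∈ T.toFinset
    · rw [Finset.insert_eq_of_mem h]
      linarith [(dist_nonneg : 0 ≤ dist s.1 s.2)]
    · rw [Finset.sum_insert h]
      linarith

/-- A graph whose segments have lengths bounded termwise by g has length ≤ Σ g. [folklore] -/
theorem len_map_le_sum {ι : Type*} (l : List ι) (F : ι → Seg d) (g : ι → ℝ)
    (h : ∀ i ∈ l, dist (F i).1 (F i).2 ≤ g i) : len (l.map F) ≤ (l.map g).sum := by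
  induction l with
  | nil => simp
  | cons i l ih =>
    rw [List.map_cons, len_cons, List.map_cons, List.sum_cons]
    exact add_le_add (h i (by simp)) (ih fun j hj => h j (by simp [hj]))

/-- Σ (w/2 + c) over a list = (Σ w)/2 + (length)·c. [folklore] -/
theorem sum_map_half_add (l : List (RPt d × ℝ)) (c : ℝ) :
    (l.map fun x => x.2 / 2 + c).sum = (l.map Prod.snd).sum / 2 + (l.length : ℝ) * c := by
  induction l with
  | nil => simp
  | cons x l ih =>
    simp only [List.map_cons, List.sum_cons, List.length_cons, ih]
    push_cast
    ring

/-- Admissibility depends on the graph only through its carrier. [folklore] -/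
theorem admissible_of_carrier_eq {X : Finset (Pt d)} {T T' : List (Seg d)} (hT : Admissible X T)
    (h : carrier T' = carrier T) : Admissible X T' := by
  refine ⟨?_, ?_, ?_⟩
  · rw [h]; exact hT.connected
  · rw [h]; exact hT.subset
  · intro x hx; rw [h]; exact hT.meets x hx

/-! ## Part 2. Subdividing the segments of a graph into n equal parts -/

/-- The segment s cut into n equal consecutive sub-segments [γ_s(j/n), γ_s((j+1)/n)], j < n. [folklore] -/
def splitSeg (n : ℕ) (s : Seg d) : List (Seg d) :=
  (List.range n).map fun j : ℕ => (gam s ((j : ℝ) / n), gam s (((j : ℝ) + 1) / n))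

/-- The graph T with every segment cut into n equal parts. [folklore] -/
def subdiv (n : ℕ) : List (Seg d) → List (Seg d)
  | [] => []
  | s :: T => splitSeg n s ++ subdiv n T

/-- Each part of a segment cut into n ≥ 1 parts has length (length of the segment)/n. [folklore] -/
theorem dist_of_mem_splitSeg {n : ℕ} (hn : 0 < n) {s s' : Seg d} (h : s' ∈ splitSeg n s) :
    dist s'.1 s'.2 = dist s.1 s.2 / n := by
  unfold splitSeg at h
  rw [List.mem_map] at h
  obtain ⟨j, -, rfl⟩ := h
  dsimp only
  rw [dist_gam_gam]
  have hn' : (0 : ℝ) < n := by exact_mod_cast hn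
  have e : ((j : ℝ) + 1) / n - (j : ℝ) / n = 1 / n := by
    rw [← sub_div, add_sub_cancel_left]
  rw [e, abs_of_pos (by positivity)]
  ring

/-- A graph all of whose segments have the same length c has length (number of segments)·c. [folklore] -/
theorem len_eq_mul_of_forall {T : List (Seg d)} {c : ℝ} (h : ∀ s ∈ T, dist s.1 s.2 = c) :
    len T = (T.length : ℝ) * c := by
  induction T with
  | nil => simp
  | cons s T ih =>
    rw [len_cons, List.length_cons, h s (by simp), ih fun s' hs' => h s' (by simp [hs'])]
    push_cast
    ring

/-- Cutting a segment into n ≥ 1 parts preserves its length. [folklore] -/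
theorem len_splitSeg {n : ℕ} (hn : 0 < n) (s : Seg d) : len (splitSeg n s) = dist s.1 s.2 := by
  rw [len_eq_mul_of_forall fun s' hs' => dist_of_mem_splitSeg hn hs']
  unfold splitSeg
  rw [List.length_map, List.length_range]
  have hn' : (n : ℝ) ≠ 0 := by exact_mod_cast hn.ne'
  field_simp

/-- Cutting a segment into n ≥ 1 parts preserves its point set. [folklore] -/
theorem carrier_splitSeg {n : ℕ} (hn : 0 < n) (s : Seg d) : carrier (splitSeg n s) = segment ℝ s.1 s.2 := by
  have hn' : (0 : ℝ) < n := by exact_mod_cast hn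
  apply Set.Subset.antisymm
  · intro z hz
    obtain ⟨s', hs', hz⟩ := mem_carrier.1 hz
    unfold splitSeg at hs'
    rw [List.mem_map] at hs'
    obtain ⟨j, hj, rfl⟩ := hs'
    rw [List.mem_range] at hj
    have hj1 : (j : ℝ) + 1 ≤ n := by exact_mod_cast hj
    refine (convex_segment s.1 s.2).segment_subset (gam_mem_segment s ?_ ?_) (gam_mem_segment s ?_ ?_) hz
    · positivity
    · rw [div_le_one hn']
      linarith
    · positivity
    · rw [div_le_one hn']
      exact hj1
  · intro z hz
    rw [segment_eq_image_gam] at hz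
    obtain ⟨t, ⟨ht0, ht1⟩, rfl⟩ := hz
    obtain ⟨j, hjn, hj1, hj2⟩ : ∃ j : ℕ, j < n ∧ (j : ℝ) / n ≤ t ∧ t ≤ ((j : ℝ) + 1) / n := by
      rcases Nat.lt_or_ge ⌊t * n⌋₊ n with h | h
      · refine ⟨⌊t * n⌋₊, h, ?_, ?_⟩
        · rw [div_le_iff₀ hn']
          exact Nat.floor_le (by positivity)
        · rw [le_div_iff₀ hn']
          exact (Nat.lt_floor_add_one (t * n)).le
      · refine ⟨n - 1, by omega, ?_, ?_⟩
        · rw [div_le_iff₀ hn']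
          have h1 : ((n - 1 : ℕ) : ℝ) ≤ ⌊t * n⌋₊ := by exact_mod_cast (by omega : n - 1 ≤ ⌊t * n⌋₊)
          exact h1.trans (Nat.floor_le (by positivity))
        · have e : ((n - 1 : ℕ) : ℝ) + 1 = n := by
            rw [Nat.cast_sub (by omega), Nat.cast_one]
            ring
          rw [e, div_self hn'.ne']
          exact ht1
    apply mem_carrier.2
    refine ⟨(gam s ((j : ℝ) / n), gam s (((j : ℝ) + 1) / n)), ?_, gam_mem_segment_gam s hj1 hj2⟩
    unfold splitSeg
    rw [List.mem_map]
    exact ⟨j, List.mem_range.2 hjn, rfl⟩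

/-- Subdivision preserves the point set of a graph. [folklore] -/
theorem carrier_subdiv {n : ℕ} (hn : 0 < n) (T : List (Seg d)) : carrier (subdiv n T) = carrier T := by
  induction T with
  | nil => rfl
  | cons s T ih => rw [subdiv, carrier_append, carrier_splitSeg hn, ih, carrier_cons]

/-- Subdivision preserves the length of a graph. [folklore] -/
theorem len_subdiv {n : ℕ} (hn : 0 < n) (T : List (Seg d)) : len (subdiv n T) = len T := by
  induction T with
  | nil => rfl
  | cons s T ih => rw [subdiv, len_append, len_splitSeg hn, ih, len_cons]

/-- After subdividing into n parts every segment has length ≤ |T|/n. [folklore] -/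
theorem dist_le_of_mem_subdiv {n : ℕ} (hn : 0 < n) {T : List (Seg d)} {s' : Seg d} (h : s' ∈ subdiv n T) :
    dist s'.1 s'.2 ≤ len T / n := by
  induction T with
  | nil => simp [subdiv] at h
  | cons s T ih =>
    rw [subdiv, List.mem_append] at h
    have hn' : (0 : ℝ) < n := by exact_mod_cast hn
    rcases h with h | h
    · rw [dist_of_mem_splitSeg hn h]
      exact div_le_div_of_nonneg_right (dist_le_len_of_mem (by simp)) hn'.le
    · refine (ih h).trans (div_le_div_of_nonneg_right ?_ hn'.le)
      rw [len_cons]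
      linarith [(dist_nonneg : 0 ≤ dist s.1 s.2)]

/-! ## Part 3. Rooted polygonal trees (a binary left-child / right-sibling encoding) -/

/-- A ROOTED POLYGONAL TREE in ℝ^d: `pt p` is the one-point tree at p; `br c t` is the tree t with one more child
subtree c hung at the root of t by the straight edge [root t, root c].  (Every finite rooted tree with straight edges
arises this way; the encoding is the binary "first child / rest of the tree" one.) [folklore] -/
inductive RT (d : ℕ) : Type
  /-- the one-point tree at p. [folklore] -/
  | pt : RPt d → RT d
  /-- `br c t`: the child subtree c hung at the root of t by the edge [root t, root c]. [folklore] -/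
  | br : RT d → RT d → RT d

namespace RT

/-- The root. [folklore] -/
def root : RT d → RPt d
  | pt p => p
  | br _ t => root t

/-- The total edge length (sup metric). [folklore] -/
def len : RT d → ℝ
  | pt _ => 0
  | br c t => dist (root t) (root c) + len c + len t

/-- The point set: the union of the (closed, straight) edges and the nodes. [folklore] -/
def carrier : RT d → Set (RPt d)
  | pt p => {p}
  | br c t => segment ℝ (root t) (root c) ∪ carrier c ∪ carrier t

/-- The height: the largest tree distance from the root to a node. [folklore] -/
def reach : RT d → ℝ
  | pt _ => 0
  | br c t => max (reach t) (dist (root t) (root c) + reach c)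

/-- All edges have length ≤ ε. [folklore] -/
def EdgeLe (ε : ℝ) : RT d → Prop
  | pt _ => True
  | br c t => dist (root t) (root c) ≤ ε ∧ EdgeLe ε c ∧ EdgeLe ε t

/-- The root of a one-point tree. [folklore] -/
@[simp] theorem root_pt (p : RPt d) : (pt p).root = p := rfl

/-- Hanging a child does not move the root. [folklore] -/
@[simp] theorem root_br (c t : RT d) : (br c t).root = t.root := rfl

/-- A one-point tree has length 0. [folklore] -/
@[simp] theorem len_pt (p : RPt d) : (pt p).len = 0 := rfl

/-- Length after hanging a child: the new edge, the child, the rest. [folklore] -/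
@[simp] theorem len_br (c t : RT d) : (br c t).len = dist t.root c.root + c.len + t.len := rfl

/-- A one-point tree is a point. [folklore] -/
@[simp] theorem carrier_pt (p : RPt d) : (pt p).carrier = {p} := rfl

/-- Point set after hanging a child: the new edge, the child, the rest. [folklore] -/
@[simp] theorem carrier_br (c t : RT d) :
    (br c t).carrier = segment ℝ t.root c.root ∪ c.carrier ∪ t.carrier := rfl

/-- A one-point tree has height 0. [folklore] -/
@[simp] theorem reach_pt (p : RPt d) : (pt p).reach = 0 := rfl

/-- Height after hanging a child. [folklore] -/
@[simp] theorem reach_br (c t : RT d) : (br c t).reach = max t.reach (dist t.root c.root + c.reach) := rfl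

/-- A one-point tree has no edges. [folklore] -/
@[simp] theorem edgeLe_pt (ε : ℝ) (p : RPt d) : (pt p).EdgeLe ε ↔ True := Iff.rfl

/-- Edge bound after hanging a child. [folklore] -/
@[simp] theorem edgeLe_br (ε : ℝ) (c t : RT d) :
    (br c t).EdgeLe ε ↔ dist t.root c.root ≤ ε ∧ c.EdgeLe ε ∧ t.EdgeLe ε := Iff.rfl

/-- Lengths are non-negative. [folklore] -/
theorem len_nonneg (R : RT d) : 0 ≤ R.len := by
  induction R with
  | pt p => simp
  | br c t ihc iht => rw [len_br]; positivity

/-- Heights are non-negative. [folklore] -/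
theorem reach_nonneg (R : RT d) : 0 ≤ R.reach := by
  induction R with
  | pt p => simp
  | br c t ihc iht => rw [reach_br]; exact le_max_of_le_left iht

/-- The height is at most the total length. [folklore] -/
theorem reach_le_len (R : RT d) : R.reach ≤ R.len := by
  induction R with
  | pt p => simp
  | br c t ihc iht =>
    rw [reach_br, len_br]
    exact max_le (by linarith [c.len_nonneg, (dist_nonneg : 0 ≤ dist t.root c.root)])
      (by linarith [t.len_nonneg])

/-- The root belongs to the tree. [folklore] -/
theorem root_mem_carrier (R : RT d) : R.root ∈ R.carrier := by
  induction R with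
  | pt p => simp
  | br c t ihc iht => rw [carrier_br, root_br]; exact Or.inr iht

/-- Every point of the tree is within (sup-)distance `reach` of the root. [folklore] -/
theorem dist_root_le_reach (R : RT d) {q : RPt d} (hq : q ∈ R.carrier) : dist R.root q ≤ R.reach := by
  induction R with
  | pt p =>
    rw [carrier_pt, Set.mem_singleton_iff] at hq
    rw [hq, root_pt, dist_self, reach_pt]
  | br c t ihc iht =>
    rw [carrier_br] at hq
    rw [root_br, reach_br]
    rcases hq with (hq | hq) | hq
    · calc dist t.root q ≤ max (dist t.root t.root) (dist t.root c.root) := dist_le_max_of_mem_segment hq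
        _ = dist t.root c.root := by rw [dist_self, max_eq_right dist_nonneg]
        _ ≤ dist t.root c.root + c.reach := le_add_of_nonneg_right c.reach_nonneg
        _ ≤ _ := le_max_right _ _
    · calc dist t.root q ≤ dist t.root c.root + dist c.root q := dist_triangle _ _ _
        _ ≤ dist t.root c.root + c.reach := by linarith [ihc hq]
        _ ≤ _ := le_max_right _ _
    · exact (iht hq).trans (le_max_left _ _)

/-! ## Part 4. The centre of a tree: every point of a tree of length w is within w/2 of one of its points -/

/-- THE DEEP-POINT LEMMA: for every 0 ≤ s ≤ reach there is a point p of the tree at distance ≤ s from the root (the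
point at depth s on a deepest branch) such that every point q of the tree is within max(reach − s, s + len − reach)
of p — q below p is within reach − s; otherwise the path climbs ≤ s and descends along a side branch of length
≤ len − reach. [folklore] -/
theorem exists_deep_point (R : RT d) {s : ℝ} (hs0 : 0 ≤ s) (hs : s ≤ R.reach) :
    ∃ p ∈ R.carrier, dist R.root p ≤ s ∧
      ∀ q ∈ R.carrier, dist p q ≤ max (R.reach - s) (s + R.len - R.reach) := by
  induction R generalizing s with
  | pt p₀ =>
    refine ⟨p₀, by simp, by simpa using hs0, fun q hq => ?_⟩
    rw [carrier_pt, Set.mem_singleton_iff] at hq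
    rw [hq, dist_self, reach_pt, len_pt]
    exact le_max_of_le_right (by linarith)
  | br c t ihc iht =>
    -- notation and elementary facts
    have he0 : 0 ≤ dist t.root c.root := dist_nonneg
    have hct : ∀ q ∈ c.carrier, dist t.root q ≤ dist t.root c.root + c.reach := fun q hq =>
      (dist_triangle t.root c.root q).trans (by linarith [c.dist_root_le_reach hq])
    have hseg : ∀ q ∈ segment ℝ t.root c.root, dist t.root q ≤ dist t.root c.root := fun q hq => by
      calc dist t.root q ≤ max (dist t.root t.root) (dist t.root c.root) := dist_le_max_of_mem_segment hq
        _ = dist t.root c.root := by rw [dist_self, max_eq_right dist_nonneg]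
    have htt : ∀ q ∈ t.carrier, dist t.root q ≤ t.reach := fun q hq => t.dist_root_le_reach hq
    have hcl := c.reach_le_len
    have htl := t.reach_le_len
    have hc0 := c.reach_nonneg
    have ht0 := t.len_nonneg
    rw [root_br, reach_br] at *
    rw [len_br]
    rcases le_or_gt (dist t.root c.root + c.reach) t.reach with hA | hB
    · -- Case A: the deepest branch is in t
      rw [max_eq_left hA] at hs ⊢
      obtain ⟨p, hp, hp1, hp2⟩ := iht hs0 hs
      refine ⟨p, Or.inr hp, hp1, fun q hq => ?_⟩
      rw [carrier_br] at hq
      have hpt : dist p t.root ≤ s := by rw [dist_comm]; exact hp1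
      rcases hq with (hq | hq) | hq
      · calc dist p q ≤ dist p t.root + dist t.root q := dist_triangle _ _ _
          _ ≤ s + dist t.root c.root := add_le_add hpt (hseg q hq)
          _ ≤ s + (dist t.root c.root + c.len + t.len) - t.reach := by linarith [c.len_nonneg]
          _ ≤ _ := le_max_right _ _
      · calc dist p q ≤ dist p t.root + dist t.root q := dist_triangle _ _ _
          _ ≤ s + (dist t.root c.root + c.reach) := add_le_add hpt (hct q hq)
          _ ≤ s + (dist t.root c.root + c.len + t.len) - t.reach := by linarith
          _ ≤ _ := le_max_right _ _
      · exact (hp2 q hq).trans (max_le_max le_rfl (by linarith [c.len_nonneg]))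
    · -- Case B: the deepest branch passes through c
      rw [max_eq_right hB.le] at hs ⊢
      rcases le_or_gt s (dist t.root c.root) with hse | hes
      · -- B1: the deep point lies on the edge [root t, root c]
        obtain ⟨p, hpseg, hp1, hp2⟩ : ∃ p ∈ segment ℝ t.root c.root,
            dist t.root p ≤ s ∧ dist p c.root ≤ dist t.root c.root - s := by
          rcases he0.eq_or_lt with he | he
          · refine ⟨t.root, left_mem_segment ℝ _ _, by rw [dist_self]; exact hs0, ?_⟩
            have hs00 : s = 0 := le_antisymm (hse.trans he.symm.le) hs0
            rw [hs00, sub_zero]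
          · refine ⟨AffineMap.lineMap t.root c.root (s / dist t.root c.root), ?_, ?_, ?_⟩
            · rw [segment_eq_image_lineMap]
              exact ⟨s / dist t.root c.root, ⟨div_nonneg hs0 he.le, (div_le_one he).2 hse⟩, rfl⟩
            · rw [dist_left_lineMap, Real.norm_eq_abs, abs_of_nonneg (div_nonneg hs0 he.le),
                div_mul_cancel₀ _ he.ne']
            · rw [dist_lineMap_right, Real.norm_eq_abs,
                abs_of_nonneg (by rw [sub_nonneg, div_le_one he]; exact hse), sub_mul, one_mul,
                div_mul_cancel₀ _ he.ne']
        refine ⟨p, Or.inl (Or.inl hpseg), hp1, fun q hq => ?_⟩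
        rw [carrier_br] at hq
        have hpt : dist p t.root ≤ s := by rw [dist_comm]; exact hp1
        rcases hq with (hq | hq) | hq
        · calc dist p q ≤ max (dist p t.root) (dist p c.root) := dist_le_max_of_mem_segment hq
            _ ≤ max (s + (dist t.root c.root + c.len + t.len) - (dist t.root c.root + c.reach))
                  (dist t.root c.root + c.reach - s) :=
                max_le_max (by linarith) (by linarith)
            _ = _ := max_comm _ _
        · calc dist p q ≤ dist p c.root + dist c.root q := dist_triangle _ _ _
            _ ≤ (dist t.root c.root - s) + c.reach := add_le_add hp2 (c.dist_root_le_reach hq)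
            _ = dist t.root c.root + c.reach - s := by ring
            _ ≤ _ := le_max_left _ _
        · calc dist p q ≤ dist p t.root + dist t.root q := dist_triangle _ _ _
            _ ≤ s + t.reach := add_le_add hpt (htt q hq)
            _ ≤ s + (dist t.root c.root + c.len + t.len) - (dist t.root c.root + c.reach) := by linarith
            _ ≤ _ := le_max_right _ _
      · -- B2: the deep point lies in the subtree c, at depth s − |edge|
        obtain ⟨p, hp, hp1, hp2⟩ := ihc (s := s - dist t.root c.root) (by linarith) (by linarith)
        have hpc : dist p c.root ≤ s - dist t.root c.root := by rw [dist_comm]; exact hp1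
        have hpt : dist p t.root ≤ s := by
          calc dist p t.root ≤ dist p c.root + dist c.root t.root := dist_triangle _ _ _
            _ ≤ (s - dist t.root c.root) + dist t.root c.root := add_le_add hpc (by rw [dist_comm])
            _ = s := by ring
        refine ⟨p, Or.inl (Or.inr hp), by rw [dist_comm]; exact hpt, fun q hq => ?_⟩
        rw [carrier_br] at hq
        rcases hq with (hq | hq) | hq
        · calc dist p q ≤ max (dist p t.root) (dist p c.root) := dist_le_max_of_mem_segment hq
            _ ≤ s := max_le hpt (by linarith)
            _ ≤ s + (dist t.root c.root + c.len + t.len) - (dist t.root c.root + c.reach) := by linarith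
            _ ≤ _ := le_max_right _ _
        · exact (hp2 q hq).trans (max_le_max (by linarith) (by linarith))
        · calc dist p q ≤ dist p t.root + dist t.root q := dist_triangle _ _ _
            _ ≤ s + t.reach := add_le_add hpt (htt q hq)
            _ ≤ s + (dist t.root c.root + c.len + t.len) - (dist t.root c.root + c.reach) := by linarith
            _ ≤ _ := le_max_right _ _

/-- THE CENTRE OF A TREE: a (finite, polygonal) tree of total length w has a point within sup-distance w/2 of each of
its points (the midpoint of a longest path; here: the point at depth reach − w/2 on a deepest branch, or the root if
reach ≤ w/2). [folklore] -/
theorem exists_centre (R : RT d) : ∃ m ∈ R.carrier, ∀ q ∈ R.carrier, dist m q ≤ R.len / 2 := by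
  rcases le_or_gt R.reach (R.len / 2) with h | h
  · exact ⟨R.root, R.root_mem_carrier, fun q hq => (R.dist_root_le_reach hq).trans h⟩
  · obtain ⟨p, hp, -, hp2⟩ :=
      R.exists_deep_point (s := R.reach - R.len / 2) (by linarith) (by linarith [R.len_nonneg])
    exact ⟨p, hp, fun q hq => (hp2 q hq).trans (max_le (by linarith) (by linarith))⟩


/-! ## Part 5. Hanging a segment on a tree; a rooted tree spanning a connected polygonal graph -/

/-- HANGING A SEGMENT: if m is a point of the tree R and a any point, there is a tree with point set
carrier R ∪ [m, a], total length len R + |m − a| and the same root (subdivide the edge through m if m is not a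
node, then hang the edge [m, a] at m); edge lengths stay ≤ ε if |m − a| ≤ ε. [folklore] -/
theorem exists_hang (R : RT d) {m : RPt d} (hm : m ∈ R.carrier) (a : RPt d) {ε : ℝ} (hR : R.EdgeLe ε)
    (ha : dist m a ≤ ε) :
    ∃ R' : RT d, R'.carrier = R.carrier ∪ segment ℝ m a ∧ R'.len = R.len + dist m a ∧
      R'.root = R.root ∧ R'.EdgeLe ε := by
  induction R with
  | pt p =>
    rw [carrier_pt, Set.mem_singleton_iff] at hm
    subst hm
    refine ⟨br (pt a) (pt m), ?_, by simp, rfl, ?_⟩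
    · rw [carrier_br, carrier_pt, carrier_pt, root_pt, root_pt]
      ext z
      simp only [Set.mem_union, Set.mem_singleton_iff]
      constructor
      · rintro ((h | rfl) | rfl)
        · exact Or.inr h
        · exact Or.inr (right_mem_segment ℝ _ _)
        · exact Or.inl rfl
      · rintro (rfl | h)
        · exact Or.inr rfl
        · exact Or.inl (Or.inl h)
    · rw [edgeLe_br, root_pt, root_pt, edgeLe_pt, edgeLe_pt]
      exact ⟨ha, trivial, trivial⟩
  | br c t ihc iht =>
    rw [edgeLe_br] at hR
    obtain ⟨he, hc, ht⟩ := hR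
    rw [carrier_br] at hm
    by_cases hmt : m ∈ t.carrier
    · obtain ⟨t', h1, h2, h3, h4⟩ := iht hmt ht
      refine ⟨br c t', ?_, ?_, ?_, ?_⟩
      · rw [carrier_br, carrier_br, h1, h3, ← Set.union_assoc]
      · rw [len_br, len_br, h2, h3]
        ring
      · rw [root_br, root_br, h3]
      · rw [edgeLe_br, h3]
        exact ⟨he, hc, h4⟩
    by_cases hmc : m ∈ c.carrier
    · obtain ⟨c', h1, h2, h3, h4⟩ := ihc hmc hc
      refine ⟨br c' t, ?_, ?_, rfl, ?_⟩
      · rw [carrier_br, carrier_br, h1, h3]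
        ext z
        simp only [Set.mem_union]
        tauto
      · rw [len_br, len_br, h2, h3]
        ring
      · rw [edgeLe_br, h3]
        exact ⟨he, h4, ht⟩
    · -- m lies on the edge [root t, root c]: subdivide it at m and hang [m, a] there
      have hms : m ∈ segment ℝ t.root c.root := by
        rcases hm with (h | h) | h
        · exact h
        · exact absurd h hmc
        · exact absurd h hmt
      have hsplit := dist_add_dist_of_mem_segment hms
      have hsub1 : segment ℝ t.root m ⊆ segment ℝ t.root c.root :=
        (convex_segment _ _).segment_subset (left_mem_segment ℝ _ _) hms
      have hsub2 : segment ℝ m c.root ⊆ segment ℝ t.root c.root :=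
        (convex_segment _ _).segment_subset hms (right_mem_segment ℝ _ _)
      refine ⟨br (br (pt a) (br c (pt m))) t, ?_, ?_, rfl, ?_⟩
      · simp only [carrier_br, carrier_pt, root_br, root_pt]
        apply Set.Subset.antisymm
        · intro z hz
          simp only [Set.mem_union, Set.mem_singleton_iff] at hz ⊢
          rcases hz with (hz | ((hz | rfl) | ((hz | hz) | rfl))) | hz
          · exact Or.inl (Or.inl (Or.inl (hsub1 hz)))
          · exact Or.inr hz
          · exact Or.inr (right_mem_segment ℝ _ _)
          · exact Or.inl (Or.inl (Or.inl (hsub2 hz)))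
          · exact Or.inl (Or.inl (Or.inr hz))
          · exact Or.inl (Or.inl (Or.inl hms))
          · exact Or.inl (Or.inr hz)
        · intro z hz
          simp only [Set.mem_union, Set.mem_singleton_iff] at hz ⊢
          rcases hz with ((hz | hz) | hz) | hz
          · rcases segment_subset_union hms hz with h | h
            · exact Or.inl (Or.inl h)
            · exact Or.inl (Or.inr (Or.inr (Or.inl (Or.inl h))))
          · exact Or.inl (Or.inr (Or.inr (Or.inl (Or.inr hz))))
          · exact Or.inr hz
          · exact Or.inl (Or.inr (Or.inl (Or.inl hz)))
      · simp only [len_br, len_pt, root_br, root_pt]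
        linarith
      · simp only [edgeLe_br, edgeLe_pt, root_br, root_pt]
        have h1 : dist t.root m ≤ ε := by linarith [(dist_nonneg : 0 ≤ dist m c.root)]
        have h2 : dist m c.root ≤ ε := by linarith [(dist_nonneg : 0 ≤ dist t.root m)]
        exact ⟨h1, ⟨ha, trivial, h2, hc, trivial⟩, ht⟩

/-- A ROOTED TREE SPANNING A CONNECTED POLYGONAL GRAPH: a non-empty finite family U of segments with (pre)connected
union is the point set of a rooted polygonal tree of total length ≤ Σ_{s ∈ U} |s| whose edges are no longer than the
longest segment (grow the tree one segment at a time: by connectedness some unused segment meets the current tree;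
hang its two halves at the meeting point). [folklore] -/
theorem exists_RT (U : Finset (Seg d)) (hU : U.Nonempty) {ε : ℝ} (hε : ∀ s ∈ U, dist s.1 s.2 ≤ ε)
    (hconn : IsPreconnected (⋃ s ∈ U, segment ℝ s.1 s.2)) :
    ∃ R : RT d, R.carrier = ⋃ s ∈ U, segment ℝ s.1 s.2 ∧ R.len ≤ ∑ s ∈ U, dist s.1 s.2 ∧ R.EdgeLe ε := by
  classical
  -- a tree for one segment
  have one : ∀ s ∈ U, ∃ R : RT d, R.carrier = segment ℝ s.1 s.2 ∧ R.len = dist s.1 s.2 ∧ R.EdgeLe ε := by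
    intro s hs
    obtain ⟨R, h1, h2, -, h4⟩ :=
      exists_hang (pt s.1) (by simp) s.2 (by simp) (hε s hs)
    refine ⟨R, ?_, by simpa using h2, h4⟩
    rw [h1, carrier_pt]
    exact Set.union_eq_self_of_subset_left (Set.singleton_subset_iff.2 (left_mem_segment ℝ _ _))
  -- growing sub-families D ⊆ U with a spanning tree
  have grow : ∀ k : ℕ, 1 ≤ k → k ≤ U.card → ∃ D : Finset (Seg d), D ⊆ U ∧ D.card = k ∧
      ∃ R : RT d, R.carrier = ⋃ s ∈ D, segment ℝ s.1 s.2 ∧ R.len ≤ ∑ s ∈ D, dist s.1 s.2 ∧ R.EdgeLe ε := by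
    intro k hk
    induction k, hk using Nat.le_induction with
    | base =>
      intro _
      obtain ⟨s, hs⟩ := hU
      obtain ⟨R, h1, h2, h4⟩ := one s hs
      refine ⟨{s}, Finset.singleton_subset_iff.2 hs, Finset.card_singleton s, R, ?_, ?_, h4⟩
      · rw [h1]
        simp
      · rw [h2]
        simp
    | succ k hk ih =>
      intro hkU
      obtain ⟨D, hDU, hDk, R, hRc, hRl, hRe⟩ := ih (by omega)
      have hDne : D.Nonempty := by
        rw [← Finset.card_pos]
        omega
      have hsd : ∃ s ∈ U, s ∉ D := by
        have : ¬ U ⊆ D := fun h => by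
          have := Finset.card_le_card h
          omega
        exact Finset.not_subset.1 this
      have hAB : (⋃ s ∈ U, segment ℝ s.1 s.2) =
          (⋃ s ∈ D, segment ℝ s.1 s.2) ∪ ⋃ s ∈ U \ D, segment ℝ s.1 s.2 := by
        conv_lhs => rw [← Finset.union_sdiff_of_subset hDU]
        rw [Finset.set_biUnion_union]
      have hAc : IsClosed (⋃ s ∈ D, segment ℝ s.1 s.2) :=
        isClosed_biUnion_finset fun s _ => isClosed_segment' s
      have hBc : IsClosed (⋃ s ∈ U \ D, segment ℝ s.1 s.2) :=
        isClosed_biUnion_finset fun s _ => isClosed_segment' s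
      have hAne : (⋃ s ∈ D, segment ℝ s.1 s.2).Nonempty := by
        obtain ⟨s, hs⟩ := hDne
        exact ⟨s.1, Set.mem_iUnion₂.2 ⟨s, hs, left_mem_segment ℝ _ _⟩⟩
      have hBne : (⋃ s ∈ U \ D, segment ℝ s.1 s.2).Nonempty := by
        obtain ⟨s, hsU, hsD⟩ := hsd
        exact ⟨s.1, Set.mem_iUnion₂.2 ⟨s, Finset.mem_sdiff.2 ⟨hsU, hsD⟩, left_mem_segment ℝ _ _⟩⟩
      -- by connectedness the used and the unused segments meet
      have hmeet : ((⋃ s ∈ D, segment ℝ s.1 s.2) ∩ ⋃ s ∈ U \ D, segment ℝ s.1 s.2).Nonempty := by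
        by_contra h
        rw [Set.not_nonempty_iff_eq_empty] at h
        have h' := (isPreconnected_iff_subset_of_disjoint_closed.1 hconn) _ _ hAc hBc hAB.le
          (by rw [h, Set.inter_empty])
        rcases h' with h' | h'
        · obtain ⟨x, hx⟩ := hBne
          have hxA := h' (by rw [hAB]; exact Or.inr hx)
          have hx' : x ∈ (⋃ s ∈ D, segment ℝ s.1 s.2) ∩ ⋃ s ∈ U \ D, segment ℝ s.1 s.2 := ⟨hxA, hx⟩
          rw [h] at hx'
          exact hx'
        · obtain ⟨x, hx⟩ := hAne
          have hxB := h' (by rw [hAB]; exact Or.inl hx)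
          have hx' : x ∈ (⋃ s ∈ D, segment ℝ s.1 s.2) ∩ ⋃ s ∈ U \ D, segment ℝ s.1 s.2 := ⟨hx, hxB⟩
          rw [h] at hx'
          exact hx'
      obtain ⟨m, hmA, hmB⟩ := hmeet
      rw [Set.mem_iUnion₂] at hmB
      obtain ⟨s, hs, hms⟩ := hmB
      rw [Finset.mem_sdiff] at hs
      obtain ⟨hsU, hsD⟩ := hs
      have hmR : m ∈ R.carrier := by
        rw [hRc]
        exact hmA
      have hsplit := dist_add_dist_of_mem_segment hms
      have hms1 : dist m s.1 = dist s.1 m := dist_comm _ _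
      have hd1 : dist m s.1 ≤ ε := by
        linarith [hε s hsU, (dist_nonneg : 0 ≤ dist m s.2)]
      have hd2 : dist m s.2 ≤ ε := by
        linarith [hε s hsU, (dist_nonneg : 0 ≤ dist s.1 m)]
      obtain ⟨R₁, h1c, h1l, -, h1e⟩ := exists_hang R hmR s.1 hRe hd1
      have hmR₁ : m ∈ R₁.carrier := by
        rw [h1c]
        exact Or.inl hmR
      obtain ⟨R₂, h2c, h2l, -, h2e⟩ := exists_hang R₁ hmR₁ s.2 h1e hd2
      refine ⟨insert s D, Finset.insert_subset hsU hDU, by rw [Finset.card_insert_of_notMem hsD, hDk],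
        R₂, ?_, ?_, h2e⟩
      · rw [h2c, h1c, hRc, Finset.set_biUnion_insert, Set.union_assoc, segment_union_eq_of_mem hms,
          Set.union_comm]
      · rw [h2l, h1l, Finset.sum_insert hsD]
        linarith
  obtain ⟨D, hDU, hDk, R, hRc, hRl, hRe⟩ := grow U.card (Finset.card_pos.2 hU) le_rfl
  have hDU' : D = U := Finset.eq_of_subset_of_card_le hDU (by rw [hDk])
  subst hDU'
  exact ⟨R, hRc, hRl, hRe⟩

/-! ## Part 6. Cutting a tree into pieces of length between θ and 2θ + (longest edge) -/

/-- THE CUTTING LEMMA: a rooted tree with edges ≤ ε splits, for every θ > 0, into sub-trees ("pieces") each of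
total length in [θ, 2θ + ε) and one residual sub-tree containing the root ("stub") of length < θ, the lengths adding
up to the length of the tree and the point sets covering it (bottom-up: a node whose pending sub-tree reaches length
θ is cut off). [folklore] -/
theorem exists_cut {θ ε : ℝ} (hθ : 0 < θ) (R : RT d) (hR : R.EdgeLe ε) :
    ∃ (Ps : List (RT d)) (S : RT d), S.root = R.root ∧ S.len < θ ∧
      (∀ P ∈ Ps, θ ≤ P.len ∧ P.len < 2 * θ + ε) ∧
      (Ps.map RT.len).sum + S.len = R.len ∧
      (∀ P ∈ Ps, P.carrier ⊆ R.carrier) ∧ S.carrier ⊆ R.carrier ∧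
      (∀ q ∈ R.carrier, (∃ P ∈ Ps, q ∈ P.carrier) ∨ q ∈ S.carrier) := by
  induction R with
  | pt p =>
    exact ⟨[], pt p, rfl, by simpa using hθ, by simp, by simp, by simp, subset_rfl, fun q hq => Or.inr hq⟩
  | br c t ihc iht =>
    rw [edgeLe_br] at hR
    obtain ⟨he, hc, ht⟩ := hR
    obtain ⟨Pc, Sc, hc1, hc2, hc3, hc4, hc5, hc6, hc7⟩ := ihc hc
    obtain ⟨Pt, St, ht1, ht2, ht3, ht4, ht5, ht6, ht7⟩ := iht ht
    have hcand_len : (br Sc St).len = dist t.root c.root + Sc.len + St.len := by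
      rw [len_br, hc1, ht1]
    have hcand_carrier : (br Sc St).carrier = segment ℝ t.root c.root ∪ Sc.carrier ∪ St.carrier := by
      rw [carrier_br, hc1, ht1]
    have hcand_sub : (br Sc St).carrier ⊆ (br c t).carrier := by
      rw [hcand_carrier, carrier_br]
      exact Set.union_subset_union (Set.union_subset_union subset_rfl hc6) ht6
    have hPc_sub : ∀ P ∈ Pc, P.carrier ⊆ (br c t).carrier := fun P hP z hz => by
      rw [carrier_br]
      exact Or.inl (Or.inr (hc5 P hP hz))
    have hPt_sub : ∀ P ∈ Pt, P.carrier ⊆ (br c t).carrier := fun P hP z hz => by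
      rw [carrier_br]
      exact Or.inr (ht5 P hP hz)
    have hcov : ∀ q ∈ (br c t).carrier, (∃ P ∈ Pc ++ Pt, q ∈ P.carrier) ∨ q ∈ (br Sc St).carrier := by
      intro q hq
      rw [carrier_br] at hq
      rw [hcand_carrier]
      rcases hq with (hq | hq) | hq
      · exact Or.inr (Or.inl (Or.inl hq))
      · rcases hc7 q hq with ⟨P, hP, hqP⟩ | h
        · exact Or.inl ⟨P, List.mem_append.2 (Or.inl hP), hqP⟩
        · exact Or.inr (Or.inl (Or.inr h))
      · rcases ht7 q hq with ⟨P, hP, hqP⟩ | h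
        · exact Or.inl ⟨P, List.mem_append.2 (Or.inr hP), hqP⟩
        · exact Or.inr (Or.inr h)
    have hboth : ∀ P ∈ Pc ++ Pt, (θ ≤ P.len ∧ P.len < 2 * θ + ε) ∧ P.carrier ⊆ (br c t).carrier := by
      intro P hP
      rcases List.mem_append.1 hP with hP | hP
      · exact ⟨hc3 P hP, hPc_sub P hP⟩
      · exact ⟨ht3 P hP, hPt_sub P hP⟩
    by_cases hθc : θ ≤ (br Sc St).len
    · -- the pending sub-tree is long enough: cut it off, the stub is the bare root
      refine ⟨br Sc St :: (Pc ++ Pt), pt t.root, rfl, by simpa using hθ, ?_, ?_, ?_, ?_, ?_⟩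
      · intro P hP
        rcases List.mem_cons.1 hP with rfl | hP
        · exact ⟨hθc, by rw [hcand_len]; linarith⟩
        · exact (hboth P hP).1
      · simp only [List.map_cons, List.map_append, List.sum_cons, List.sum_append, len_pt, len_br]
        rw [hc1, ht1]
        linarith
      · intro P hP
        rcases List.mem_cons.1 hP with rfl | hP
        · exact hcand_sub
        · exact (hboth P hP).2
      · rw [carrier_pt, Set.singleton_subset_iff, carrier_br]
        exact Or.inr t.root_mem_carrier
      · intro q hq
        rcases hcov q hq with ⟨P, hP, hqP⟩ | h
        · exact Or.inl ⟨P, List.mem_cons_of_mem _ hP, hqP⟩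
        · exact Or.inl ⟨br Sc St, List.mem_cons.2 (Or.inl rfl), h⟩
    · -- the pending sub-tree is still short: pass it up
      push Not at hθc
      refine ⟨Pc ++ Pt, br Sc St, by rw [root_br, root_br, ht1], hθc, fun P hP => (hboth P hP).1, ?_,
        fun P hP => (hboth P hP).2, hcand_sub, hcov⟩
      simp only [List.map_append, List.sum_append, len_br]
      rw [hc1, ht1]
      linarith

/-- THE PIECES: for θ > 0 and a rooted tree with edges ≤ ε (ε ≥ 0) there is a finite list of (centre, weight) pairs —
one per piece and one for the stub of `exists_cut`, the centre being the piece's centre (`exists_centre`) and the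
weight its length — such that: centres lie on the tree; weights are ≥ 0 and < 2θ + ε; every point of the tree is
within weight/2 of the corresponding centre; the weights add up to the length of the tree; and (number of pairs − 1)·θ
≤ length of the tree. [folklore] -/
theorem exists_pieces {θ ε : ℝ} (hθ : 0 < θ) (hε : 0 ≤ ε) (R : RT d) (hR : R.EdgeLe ε) :
    ∃ l : List (RPt d × ℝ),
      (∀ x ∈ l, x.1 ∈ R.carrier ∧ 0 ≤ x.2 ∧ x.2 < 2 * θ + ε) ∧
      (∀ q ∈ R.carrier, ∃ x ∈ l, dist x.1 q ≤ x.2 / 2) ∧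
      (l.map Prod.snd).sum = R.len ∧ ((l.length : ℝ) - 1) * θ ≤ R.len := by
  obtain ⟨Ps, S, -, hS, hPl, hsum, hPsub, hSsub, hcov⟩ := exists_cut hθ R hR
  have hcen : ∀ P : RT d, ∃ m ∈ P.carrier, ∀ q ∈ P.carrier, dist m q ≤ P.len / 2 := exists_centre
  choose m hm hmq using hcen
  refine ⟨(S :: Ps).map fun P => (m P, P.len), ?_, ?_, ?_, ?_⟩
  · intro x hx
    rw [List.mem_map] at hx
    obtain ⟨P, hP, rfl⟩ := hx
    rcases List.mem_cons.1 hP with rfl | hP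
    · exact ⟨hSsub (hm _), RT.len_nonneg _, by linarith⟩
    · exact ⟨hPsub P hP (hm P), P.len_nonneg, (hPl P hP).2⟩
  · intro q hq
    rcases hcov q hq with ⟨P, hP, hqP⟩ | hqS
    · exact ⟨(m P, P.len), List.mem_map.2 ⟨P, List.mem_cons_of_mem _ hP, rfl⟩, hmq P q hqP⟩
    · exact ⟨(m S, S.len), List.mem_map.2 ⟨S, List.mem_cons.2 (Or.inl rfl), rfl⟩, hmq S q hqS⟩
  · have e : ((S :: Ps).map fun P => (m P, P.len)).map Prod.snd = (S :: Ps).map RT.len := by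
      rw [List.map_map]
      rfl
    rw [e, List.map_cons, List.sum_cons]
    linarith
  · rw [List.length_map, List.length_cons]
    push_cast
    have h1 : (Ps.map RT.len).length • θ ≤ (Ps.map RT.len).sum :=
      List.card_nsmul_le_sum (Ps.map RT.len) θ fun x hx => by
        rw [List.mem_map] at hx
        obtain ⟨P, hP', rfl⟩ := hx
        exact (hPl P hP').1
    rw [List.length_map, nsmul_eq_mul] at h1
    have h2 : ((Ps.length : ℝ) + 1 - 1) * θ = (Ps.length : ℝ) * θ := by ring
    rw [h2]
    linarith [S.len_nonneg]

end RT

/-! ## Part 7. The centre net of a connected polygonal graph; the whisker construction for Z′ -/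

/-- THE CENTRE NET OF A CONNECTED POLYGONAL GRAPH (free of Z, L and of the cubes — the reusable core of the
construction; a periodic twin needs only this and its own corner-point lemma): for every θ > 0 and ε > 0, a graph T
with connected carrier carries finitely many weighted points (m_i, w_i), m_i ∈ T, 0 ≤ w_i < 2θ + ε, such that every
point of T is within w_i/2 of some m_i, Σ w_i ≤ |T| and (#points − 1)·θ ≤ |T| (subdivide the segments to length ≤ ε,
span by a rooted tree, cut into pieces, take centres: Parts 2–6). [folklore] -/
theorem exists_centre_net {T : List (Seg d)} (hT : IsConnected (carrier T)) {θ ε : ℝ} (hθ : 0 < θ) (hε : 0 < ε) :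
    ∃ l : List (RPt d × ℝ),
      (∀ x ∈ l, x.1 ∈ carrier T ∧ 0 ≤ x.2 ∧ x.2 < 2 * θ + ε) ∧
      (∀ q ∈ carrier T, ∃ x ∈ l, dist x.1 q ≤ x.2 / 2) ∧
      (l.map Prod.snd).sum ≤ len T ∧ ((l.length : ℝ) - 1) * θ ≤ len T := by
  classical
  -- a subdivision T₂ of T with segments ≤ ε
  obtain ⟨n, hn, hnε⟩ : ∃ n : ℕ, 0 < n ∧ len T / n ≤ ε := by
    refine ⟨⌈len T / ε⌉₊ + 1, by omega, ?_⟩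
    have h2 : (0 : ℝ) < ((⌈len T / ε⌉₊ + 1 : ℕ) : ℝ) := by positivity
    rw [div_le_iff₀ h2]
    have h1 : len T / ε ≤ ((⌈len T / ε⌉₊ + 1 : ℕ) : ℝ) := by
      push_cast
      linarith [Nat.le_ceil (len T / ε)]
    rw [div_le_iff₀ hε] at h1
    linarith [mul_comm ε (((⌈len T / ε⌉₊ + 1 : ℕ) : ℝ))]
  set T₂ : List (Seg d) := subdiv n T with hT₂def
  have hcar₂ : carrier T₂ = carrier T := carrier_subdiv hn T
  have hlen₂ : len T₂ = len T := len_subdiv hn T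
  have hseg₂ : ∀ s ∈ T₂, dist s.1 s.2 ≤ ε := fun s hs => (dist_le_of_mem_subdiv hn hs).trans hnε
  -- a rooted tree R spanning T₂
  have hU : T₂.toFinset.Nonempty := by
    obtain ⟨z, hz⟩ := hT.nonempty
    rw [← hcar₂] at hz
    obtain ⟨s, hs, -⟩ := mem_carrier.1 hz
    exact ⟨s, List.mem_toFinset.2 hs⟩
  have hconn : IsPreconnected (⋃ s ∈ T₂.toFinset, segment ℝ s.1 s.2) := by
    rw [← carrier_eq_biUnion, hcar₂]
    exact hT.isPreconnected
  obtain ⟨R, hRc, hRl, hRe⟩ :=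
    RT.exists_RT T₂.toFinset hU (fun s hs => hseg₂ s (List.mem_toFinset.1 hs)) hconn
  rw [← carrier_eq_biUnion, hcar₂] at hRc
  have hRlen : R.len ≤ len T := (hRl.trans (sum_toFinset_le_len T₂)).trans hlen₂.le
  -- the pieces and their centres
  obtain ⟨l, hl1, hl2, hl3, hl4⟩ := RT.exists_pieces hθ hε.le R hRe
  refine ⟨l, fun x hx => ?_, fun q hq => hl2 q (by rw [hRc]; exact hq), by rw [hl3]; exact hRlen, hl4.trans hRlen⟩
  obtain ⟨h1, h2, h3⟩ := hl1 x hx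
  exact ⟨by rw [← hRc]; exact h1, h2, h3⟩

/-- THE CONSTRUCTION (the prose GEOMETRY-236.md Theorem A with the sharpened whisker step of cell GAPS C-adv4-59
Lemma W, on the formalised carrier): let T be admissible for Z, L ≥ 3, and 0 < ρ with 2ρ + 2 < L.  Rescale T by 1/L
and take its centre net with θ = ρ/L and 2θ + ε = 1 − 2/L (`exists_centre_net`); hang at each net point m_i the
whisker [m_i, snap_{R_i} m_i], R_i = w_i/2 + 1/L < ½.  The result is admissible for Z′ — every cell of Z′ contains a
point within 1/L of the rescaled graph (`exists_corner_point`), hence within R_i of some m_i, hence the point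
snap_{R_i} m_i (`snap_mem_cube`) — and L·|T′| ≤ |T| + |T|/2 + #whiskers ≤ (3/2)|T| + 1 + |T|/ρ. [folklore] -/
theorem exists_admissible_closure_centre {L : ℕ} (hL : 3 ≤ L) {Z : Finset (Pt d)} {T : List (Seg d)}
    (hT : Admissible Z T) {ρ : ℝ} (hρ : 0 < ρ) (hρL : 2 * ρ + 2 < L) :
    ∃ T', Admissible (closureIdx L (collar Z)) T' ∧
      (L : ℝ) * len T' ≤ 3 / 2 * len T + 1 + len T / ρ := by
  classical
  have hL0 : 0 < L := by omega
  have hLr : (0 : ℝ) < L := by exact_mod_cast hL0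
  have hLne : (L : ℝ) ≠ 0 := hLr.ne'
  -- witnesses of T in the cubes of Z
  have hw : ∀ z ∈ Z, ∃ w, w ∈ carrier T ∧ w ∈ cube z := fun z hz => by
    obtain ⟨w, hw⟩ := hT.meets z hz
    exact ⟨w, hw.1, hw.2⟩
  choose! P hPT hPc using hw
  -- the rescaled graph T₁
  set T₁ : List (Seg d) := T.map (scaleSeg (L : ℝ)⁻¹) with hT₁def
  have hT₁ : Admissible (closureIdx L Z) T₁ := admissible_scale hL0 hT
  have hlen₁ : len T₁ = (L : ℝ)⁻¹ * len T := len_map_scaleSeg (inv_nonneg.2 hLr.le) T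
  have hpT₁ : ∀ z ∈ Z, (L : ℝ)⁻¹ • P z ∈ carrier T₁ := fun z hz => by
    rw [hT₁def, carrier_map_scaleSeg]
    exact Set.mem_image_of_mem _ (hPT z hz)
  -- the parameters: piece threshold θ = ρ/L, whisker weights < κ = 1 − 2/L, fineness ε = κ − 2θ
  set θ : ℝ := ρ / L with hθdef
  have hθ : 0 < θ := div_pos hρ hLr
  set κ : ℝ := 1 - 2 / L with hκdef
  have hθκ : 2 * θ < κ := by
    have h1 : (2 * ρ + 2) / L < 1 := (div_lt_one hLr).2 hρL
    have e : (2 * ρ + 2) / (L : ℝ) = 2 * (ρ / L) + 2 / L := by ring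
    rw [hθdef, hκdef]
    linarith
  set ε : ℝ := κ - 2 * θ with hεdef
  have hε : 0 < ε := by rw [hεdef]; linarith
  -- the centre net of T₁
  obtain ⟨l, hl1, hl2, hl3, hl4⟩ := exists_centre_net hT₁.connected hθ hε
  have hrad : ∀ x ∈ l, 0 ≤ x.2 / 2 + 1 / L ∧ 2 * (x.2 / 2 + 1 / L) < 1 := by
    intro x hx
    obtain ⟨-, h0, h2⟩ := hl1 x hx
    refine ⟨by positivity, ?_⟩
    have e : 2 * (x.2 / 2 + 1 / (L : ℝ)) = x.2 + 2 / L := by ring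
    rw [e]
    rw [hεdef, hκdef] at h2
    linarith
  -- the whiskers
  set W : List (Seg d) := l.map fun x => (x.1, snap (x.2 / 2 + 1 / L) x.1) with hWdef
  have hWmem : ∀ sg ∈ W, ∃ x ∈ l, sg = (x.1, snap (x.2 / 2 + 1 / L) x.1) := fun sg hsg => by
    rw [hWdef, List.mem_map] at hsg
    obtain ⟨x, hx, rfl⟩ := hsg
    exact ⟨x, hx, rfl⟩
  have hlenW : len W ≤ (l.map fun x => x.2 / 2 + 1 / (L : ℝ)).sum :=
    len_map_le_sum l _ _ fun x hx => by
      dsimp only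
      rw [dist_comm]
      exact dist_snap_le (hrad x hx).1 x.1
  refine ⟨T₁ ++ W, ⟨?_, ?_, ?_⟩, ?_⟩
  · -- connected: each whisker hangs at a point of T₁
    rw [carrier_append]
    exact isConnected_union_carrier hT₁.connected W fun sg hsg => by
      obtain ⟨x, hx, rfl⟩ := hWmem sg hsg
      exact (hl1 x hx).1
  · -- contained in the cells of Z′ (each whisker inside a cell of its base point, by `snap_mem_cube` + convexity)
    rw [carrier_append]
    refine Set.union_subset (hT₁.subset.trans (cubes_mono (closureIdx_mono L (subset_collar Z)))) ?_
    intro y hy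
    obtain ⟨sg, hsg, hy⟩ := mem_carrier.1 hy
    obtain ⟨x, hx, rfl⟩ := hWmem sg hsg
    obtain ⟨c', hc', hxc'⟩ := mem_cubes.1 (hT₁.subset (hl1 x hx).1)
    have hc'' : c' ∈ closureIdx L (collar Z) := closureIdx_mono L (subset_collar Z) hc'
    have hf : snap (x.2 / 2 + 1 / L) x.1 ∈ cube c' :=
      snap_mem_cube (hrad x hx).2 hxc' (by rw [dist_self]; exact (hrad x hx).1)
    exact cube_subset_cubes hc'' ((convex_cube _).segment_subset hxc' hf hy)
  · -- meets every cell of Z′: its corner point is within w/2 + 1/L of the centre of the piece through the witness point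
    intro c hc
    obtain ⟨z, hz, q, hqc, hq⟩ := exists_corner_point hL0 hc
    obtain ⟨x, hx, hxp⟩ := hl2 _ (hpT₁ z hz)
    have hqx : dist q x.1 ≤ x.2 / 2 + 1 / L := by
      calc dist q x.1 ≤ dist q ((L : ℝ)⁻¹ • P z) + dist ((L : ℝ)⁻¹ • P z) x.1 := dist_triangle _ _ _
        _ ≤ 1 / L + x.2 / 2 := add_le_add (hq (P z) (hPc z hz)) (by rw [dist_comm]; exact hxp)
        _ = x.2 / 2 + 1 / L := add_comm _ _
    refine ⟨snap (x.2 / 2 + 1 / L) x.1, ?_, snap_mem_cube (hrad x hx).2 hqc hqx⟩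
    rw [carrier_append]
    refine Or.inr (mem_carrier.2 ⟨(x.1, snap (x.2 / 2 + 1 / L) x.1), ?_, right_mem_segment ℝ _ _⟩)
    rw [hWdef, List.mem_map]
    exact ⟨x, hx, rfl⟩
  · -- the length accounting
    rw [len_append, hlen₁]
    have e1 : (L : ℝ) * ((L : ℝ)⁻¹ * len T + len W) = len T + L * len W := by
      rw [mul_add, ← mul_assoc, mul_inv_cancel₀ hLne, one_mul]
    rw [e1]
    have hW' : len W ≤ (L : ℝ)⁻¹ * len T / 2 + (l.length : ℝ) * (1 / L) := by
      refine hlenW.trans ?_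
      rw [sum_map_half_add]
      have := hl3.trans hlen₁.le
      linarith
    -- the number of whiskers: (N − 1)·θ ≤ |T₁| = |T|/L, θ = ρ/L
    have hN : (l.length : ℝ) ≤ 1 + len T / ρ := by
      have h1 : ((l.length : ℝ) - 1) * θ ≤ (L : ℝ)⁻¹ * len T := hl4.trans hlen₁.le
      have h2 : ((l.length : ℝ) - 1) * ρ ≤ len T := by
        have h3 := mul_le_mul_of_nonneg_left h1 hLr.le
        have e2 : (L : ℝ) * (((l.length : ℝ) - 1) * θ) = ((l.length : ℝ) - 1) * ρ := by
          rw [hθdef]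
          field_simp
        have e3 : (L : ℝ) * ((L : ℝ)⁻¹ * len T) = len T := by
          rw [← mul_assoc, mul_inv_cancel₀ hLne, one_mul]
        rwa [e2, e3] at h3
      have h4 : (l.length : ℝ) - 1 ≤ len T / ρ := by
        rw [le_div_iff₀ hρ]
        exact h2
      linarith
    -- the whiskers: L·|W| ≤ |T|/2 + N
    have h3 : (L : ℝ) * len W ≤ len T / 2 + l.length := by
      have h5 : (L : ℝ) * ((L : ℝ)⁻¹ * len T / 2 + (l.length : ℝ) * (1 / L)) = len T / 2 + l.length := by
        field_simp
      calc (L : ℝ) * len W ≤ L * ((L : ℝ)⁻¹ * len T / 2 + (l.length : ℝ) * (1 / L)) :=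
            mul_le_mul_of_nonneg_left hW' hLr.le
        _ = len T / 2 + l.length := h5
    linarith

/-! ## Part 8. The theorems: L·d_{k+1}(Z′) ≤ (3/2 + 3/(L − 2))·d_k(Z) (L ≥ 3), hence ≤ 2·d_k(Z) for L ≥ 8 -/

/-- THE GENERAL CONSTANT for the formalised tree length: for every dimension d, every L ≥ 3 and every localization
domain Z (non-empty, face-connected), with Z′ = the π_{k+1}-cubes met by Z̃,
`L · treeLen Z′ ≤ (3/2 + 3/(L − 2)) · treeLen Z` (kernel predecessor `B13Geometry236.geometry236_treeLen`:
3 + 4/(L − 2); prose C-adv4-59 Corollary B′: 3/2 + 3/(L − 2), d = 4). [cite: Balaban1988RG2Cluster, (2.36) p.19] -/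
theorem geometry236_centre {L : ℕ} (hL : 3 ≤ L) {Z : Finset (Pt d)} (hZ : Z.Nonempty) (hc : FaceConnected Z) :
    (L : ℝ) * treeLen (closureIdx L (collar Z)) ≤ (3 / 2 + 3 / ((L : ℝ) - 2)) * treeLen Z := by
  have hL0 : 0 < L := by omega
  have hLr : (0 : ℝ) < L := by exact_mod_cast hL0
  have hL3 : (3 : ℝ) ≤ L := by exact_mod_cast hL
  have hL2 : (0 : ℝ) < L - 2 := by linarith
  have htl0 : 0 ≤ treeLen Z := treeLen_nonneg Z
  have hK0 : (0 : ℝ) ≤ 3 / 2 + 3 / ((L : ℝ) - 2) := by positivity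
  have hne' : (closureIdx L (collar Z)).Nonempty := closureIdx_nonempty (hZ.mono (subset_collar Z))
  by_cases hdeg : ∀ c₁ ∈ closureIdx L (collar Z), ∀ c₂ ∈ closureIdx L (collar Z), ∀ μ, c₂ μ ≤ c₁ μ + 1
  · -- all cells of Z′ pairwise touch: the one-point graph, treeLen Z′ = 0
    obtain ⟨q, hq⟩ := exists_common_point hne' hdeg
    have h0 : treeLen (closureIdx L (collar Z)) ≤ 0 := by
      have := treeLen_le_len (admissible_point hne' hq)
      simpa using this
    calc (L : ℝ) * treeLen (closureIdx L (collar Z)) ≤ L * 0 := mul_le_mul_of_nonneg_left h0 hLr.le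
      _ = 0 := mul_zero _
      _ ≤ (3 / 2 + 3 / ((L : ℝ) - 2)) * treeLen Z := mul_nonneg hK0 htl0
  · push Not at hdeg
    obtain ⟨c₁, hc₁, c₂, hc₂, μ, hμ⟩ := hdeg
    have hfar : c₁ μ + 2 ≤ c₂ μ := by omega
    have hne : ∃ T, Admissible Z T := by
      obtain ⟨T, hT, -⟩ := exists_admissible hZ hc
      exact ⟨T, hT⟩
    -- for every ρ with 2ρ + 2 < L:  L·treeLen Z′ ≤ (3/2 + 1/(L − 2) + 1/ρ)·treeLen Z
    have key : ∀ ρ : ℝ, 0 < ρ → 2 * ρ + 2 < L →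
        (L : ℝ) * treeLen (closureIdx L (collar Z)) ≤ (3 / 2 + 1 / ((L : ℝ) - 2) + 1 / ρ) * treeLen Z := by
      intro ρ hρ hρL
      refine le_mul_treeLen (by positivity) hne fun T hT => ?_
      have hlen : (L : ℝ) - 2 ≤ len T := sub_two_le_len hL hT hc₁ hc₂ hfar
      obtain ⟨T', hT', hb⟩ := exists_admissible_closure_centre hL hT hρ hρL
      have h1 : (1 : ℝ) ≤ len T / ((L : ℝ) - 2) := by
        rw [le_div_iff₀ hL2, one_mul]
        exact hlen
      calc (L : ℝ) * treeLen (closureIdx L (collar Z)) ≤ L * len T' :=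
            mul_le_mul_of_nonneg_left (treeLen_le_len hT') hLr.le
        _ ≤ 3 / 2 * len T + 1 + len T / ρ := hb
        _ ≤ 3 / 2 * len T + len T / ((L : ℝ) - 2) + len T / ρ := by linarith
        _ = (3 / 2 + 1 / ((L : ℝ) - 2) + 1 / ρ) * len T := by ring
    rcases htl0.eq_or_lt with h0 | hpos
    · -- treeLen Z = 0
      have h := key (((L : ℝ) - 2) / 4) (by positivity) (by linarith)
      rw [← h0, mul_zero] at h
      rw [← h0, mul_zero]
      exact h
    · -- treeLen Z > 0: let ρ ↑ (L − 2)/2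
      have htne : treeLen Z ≠ 0 := hpos.ne'
      refine le_of_forall_pos_le_add fun ε hε => ?_
      set A : ℝ := 2 / ((L : ℝ) - 2) with hA
      have hA0 : 0 < A := by positivity
      have hB0 : 0 < ε / treeLen Z := div_pos hε hpos
      have hρ : 0 < 1 / (A + ε / treeLen Z) := by positivity
      have hρL : 2 * (1 / (A + ε / treeLen Z)) + 2 < L := by
        have h1 : 1 / (A + ε / treeLen Z) < 1 / A := one_div_lt_one_div_of_lt hA0 (by linarith)
        have h2 : 1 / A = ((L : ℝ) - 2) / 2 := by rw [hA, one_div_div]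
        linarith
      have h := key _ hρ hρL
      rw [one_div_one_div] at h
      have e : ε / treeLen Z * treeLen Z = ε := by field_simp
      calc (L : ℝ) * treeLen (closureIdx L (collar Z))
          ≤ (3 / 2 + 1 / ((L : ℝ) - 2) + (A + ε / treeLen Z)) * treeLen Z := h
        _ = (3 / 2 + 1 / ((L : ℝ) - 2) + A) * treeLen Z + ε / treeLen Z * treeLen Z := by ring
        _ = (3 / 2 + 3 / ((L : ℝ) - 2)) * treeLen Z + ε := by
          rw [e, hA]
          ring

/-- (2.36) p. 19 AS PRINTED, verbatim: *"The remaining exponential is bounded using the following inequality: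
2d_k(Z_i) ≧ Ld_{k+1}(Z′_i). (2.36) This inequality can be obtained by simple, but awkward, geometric and combinatoric
considerations. It follows by considering locally many possible cases."* — PROVED for the formalised tree length
`treeLen` (sup metric, pv22's conventions) in every dimension d, FOR EVERY L ≥ 8 (so for every L admitted by
[Balaban1987RG1] p. 251: *"L is an odd, positive integer > 11"*): `L · treeLen Z′ ≤ 2 · treeLen Z`, since
3/2 + 3/(L − 2) ≤ 2 iff L ≥ 8.  For 3 ≤ L ≤ 7 only `geometry236_centre` is asserted. [cite: Balaban1988RG2Cluster, (2.36) p.19] -/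
theorem geometry236_printed {L : ℕ} (hL : 8 ≤ L) {Z : Finset (Pt d)} (hZ : Z.Nonempty) (hc : FaceConnected Z) :
    (L : ℝ) * treeLen (closureIdx L (collar Z)) ≤ 2 * treeLen Z := by
  have h := geometry236_centre (by omega : 3 ≤ L) hZ hc
  have hL8 : (8 : ℝ) ≤ L := by exact_mod_cast hL
  have hK : 3 / 2 + 3 / ((L : ℝ) - 2) ≤ 2 := by
    have h1 : 3 / ((L : ℝ) - 2) ≤ 1 / 2 := by
      rw [div_le_div_iff₀ (by linarith) (by norm_num)]
      linarith
    linarith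
  exact h.trans (mul_le_mul_of_nonneg_right hK (treeLen_nonneg Z))

/-- The constant of this module, a_c(L) = 3/2 + 3/(L − 2) (the factor in `geometry236_centre`; the printed claim is the
constant 2, reached for L ≥ 8; kernel predecessor `B13Geometry236.a236` = 3 + 4/(L − 2); prose `B13.Consts.aL` =
3 + 12/(L − 2)).  Not a printed quantity (cell DIVERGENCE.md D-b13.9 / D-b13.22). [cite: Balaban1988RG2Cluster, (2.36) p.19] -/
def a236c (L : ℝ) : ℝ := 3 / 2 + 3 / (L - 2)

/-- a_c(L) > 0 for L > 2. [folklore] -/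
theorem a236c_pos {L : ℝ} (hL : 2 < L) : 0 < a236c L := by
  unfold a236c
  have : 0 < L - 2 := by linarith
  positivity

/-- a_c(L) ≤ 2 iff L ≥ 8 (for L > 2): the printed factor is reached exactly from L = 8 on. [folklore] -/
theorem a236c_le_two_iff {L : ℝ} (hL : 2 < L) : a236c L ≤ 2 ↔ 8 ≤ L := by
  unfold a236c
  have hL2 : 0 < L - 2 := by linarith
  constructor
  · intro h
    have h1 : 3 / (L - 2) ≤ 1 / 2 := by linarith
    rw [div_le_div_iff₀ hL2 (by norm_num)] at h1
    linarith
  · intro h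
    have h1 : 3 / (L - 2) ≤ 1 / 2 := by
      rw [div_le_div_iff₀ hL2 (by norm_num)]
      linarith
    linarith

/-- a_c(L) < a(L) = 3 + 4/(L − 2) (the kernel predecessor's constant) for every L > 2. [folklore] -/
theorem a236c_lt_a236 {L : ℝ} (hL : 2 < L) : a236c L < a236 L := by
  unfold a236c a236
  have hL2 : 0 < L - 2 := by linarith
  have : 3 / (L - 2) < 4 / (L - 2) := div_lt_div_of_pos_right (by norm_num) hL2
  linarith

/-- a_c(L) < aL(L) = 3 + 12/(L − 2) (the prose constant of GEOMETRY-236.md / `B13.Consts.aL`) for L > 2. [folklore] -/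
theorem a236c_lt_aL {L : ℝ} (hL : 2 < L) : a236c L < B13.Consts.aL L :=
  (a236c_lt_a236 hL).trans_le (a236_le_aL hL)

/-- a_c(13) = 39/22 (d arbitrary, L = 13 the least admitted block size). [folklore] -/
theorem a236c_thirteen : a236c 13 = 39 / 22 := by
  norm_num [a236c]

/-- The transfer factor at L = 13: 13 / a_c(13) = 22/3 = 7.33… — larger than the printed ½L = 6.5 (kernel
predecessor: 143/37 = 3.86…; prose: 143/45). [folklore] -/
theorem transferFactor_thirteen : (13 : ℝ) / a236c 13 = 22 / 3 := by
  rw [a236c_thirteen]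
  norm_num

/-- THE THEOREM IN pv11's SHAPE with this module's constant: `ScaleTransfer d L treeLen (a236c L) 0` for every d and
every L ≥ 3. [cite: Balaban1988RG2Cluster, (2.36) p.19] -/
theorem scaleTransfer_treeLen_centre {L : ℕ} (hL : 3 ≤ L) :
    ScaleTransfer d L (treeLen (d := d)) (a236c L) 0 := by
  intro Z hZ hc
  rw [add_zero]
  exact geometry236_centre hL hZ hc

/-- (2.36) AS PRINTED in pv11's shape: `B13ScaleTransfer.Ineq236Printed d L treeLen` (= `ScaleTransfer d L treeLen 2 0`,
"typed for the record only" in `…B13ScaleTransfer`) HOLDS for every d and every L ≥ 8. [cite: Balaban1988RG2Cluster, (2.36) p.19] -/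
theorem ineq236Printed_treeLen {L : ℕ} (hL : 8 ≤ L) :
    B13ScaleTransfer.Ineq236Printed d L (treeLen (d := d)) := by
  intro Z hZ hc
  rw [add_zero]
  exact geometry236_printed hL hZ hc

/-- d = 4, L = 13: 13 · d_{k+1}(Z′) ≤ (39/22) · d_k(Z) ≤ 2 · d_k(Z) for every localization domain Z ⊂ ℤ⁴.
[cite: Balaban1988RG2Cluster, (2.36) p.19] -/
theorem geometry236_centre_thirteen {Z : Finset (Pt 4)} (hZ : Z.Nonempty) (hc : FaceConnected Z) :
    (13 : ℝ) * treeLen (closureIdx 13 (collar Z)) ≤ 39 / 22 * treeLen Z := by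
  have h := geometry236_centre (d := 4) (L := 13) (by norm_num) hZ hc
  norm_num at h
  linarith

/-- The exponential form used on pp. 19–20 ((2.36) ⇒ (2.37), verbatim: *"and (1 − 5δ)κd_k(Z_i) in the exponentials
replaced by (1 − 6δ)½Lκd_{k+1}(Z′_i)"*), now WITH THE PRINTED ½L: for every rate c ≥ 0 and every L ≥ 8,
`exp(−c·d_k(Z)) ≤ exp(−c·(L/2)·d_{k+1}(Z′))`. [cite: Balaban1988RG2Cluster, p.20 (after (2.36))] -/
theorem exp_transfer_printed {L : ℕ} (hL : 8 ≤ L) {Z : Finset (Pt d)} (hZ : Z.Nonempty) (hc : FaceConnected Z)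
    {c : ℝ} (hc0 : 0 ≤ c) :
    Real.exp (-(c * treeLen Z)) ≤
      Real.exp (-(c * ((L : ℝ) / 2) * treeLen (closureIdx L (collar Z)))) := by
  have h := geometry236_printed hL hZ hc
  have h' : (L : ℝ) / 2 * treeLen (closureIdx L (collar Z)) ≤ treeLen Z := by
    rw [div_mul_eq_mul_div, div_le_iff₀ (by norm_num : (0 : ℝ) < 2)]
    linarith
  apply Real.exp_le_exp.mpr
  have := mul_le_mul_of_nonneg_left h' hc0
  rw [← mul_assoc] at this
  linarith

/-! ## Part 9. The printed transfer inequality `B13.Ineq236Printed` for pv22's concrete window systems, as a theorem -/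

/-- (2.36) AS PRINTED, AS A THEOREM for the concrete carrier: for pv22's window systems `sys B_k`, `sys B_{k+1}`
(d_j := `treeLen`) and the closure map Z ↦ Z′ of `B13Geometry236.closureDom`, b13's `B13.Ineq236Printed (sys B_k)
(sys B_{k+1}) (Z ↦ Z′) L` — i.e. `B13.Ineq236With … (L/2)`, the transfer input of `B13.exp_transfer_of_ineq236With` /
`B13.Lemma3With` / `B13.Consts.R22gen` / `B13Closing.deliverables_window` AT THE PRINTED ℓ = ½L — HOLDS for every d
and every L ≥ 8. [cite: Balaban1988RG2Cluster, (2.36) p.19] -/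
theorem ineq236Printed_window {L : ℕ} (hL : 8 ≤ L) {Bk Bk1 : Finset (Pt d)} (hB : closureIdx L (collar Bk) ⊆ Bk1) :
    B13.Ineq236Printed (TreeLengthCubeSystem.sys Bk) (TreeLengthCubeSystem.sys Bk1)
      (closureDom (by omega : 0 < L) hB) L := by
  unfold B13.Ineq236Printed
  refine B13.ineq236With_of_pointwise (by norm_num : (0 : ℝ) < 2) fun X => ?_
  show (L : ℝ) * treeLen (closureIdx L (collar X.1)) ≤ 2 * treeLen X.1
  exact geometry236_printed hL X.2.2.1 X.2.2.2

/-- The natural choice of the next window, B_{k+1} := (B̃_k)′ itself, at the printed ℓ = ½L. [folklore] -/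
theorem ineq236Printed_window_self {L : ℕ} (hL : 8 ≤ L) (Bk : Finset (Pt d)) :
    B13.Ineq236Printed (TreeLengthCubeSystem.sys Bk) (TreeLengthCubeSystem.sys (closureIdx L (collar Bk)))
      (closureDom (by omega : 0 < L) subset_rfl) L :=
  ineq236Printed_window hL subset_rfl

/-- The general-L form for the concrete carrier: `B13.Ineq236With (sys B_k) (sys B_{k+1}) (Z ↦ Z′) (L / a236c L)` for
every d and every L ≥ 3 (transfer factor 22/3 at L = 13, `transferFactor_thirteen`). [cite: Balaban1988RG2Cluster, (2.36) p.19] -/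
theorem ineq236With_window_centre {L : ℕ} (hL : 3 ≤ L) {Bk Bk1 : Finset (Pt d)}
    (hB : closureIdx L (collar Bk) ⊆ Bk1) :
    B13.Ineq236With (TreeLengthCubeSystem.sys Bk) (TreeLengthCubeSystem.sys Bk1)
      (closureDom (by omega : 0 < L) hB) ((L : ℝ) / a236c L) := by
  have hL3 : (3 : ℝ) ≤ L := by exact_mod_cast hL
  refine B13.ineq236With_of_pointwise (a236c_pos (by linarith)) fun X => ?_
  show (L : ℝ) * treeLen (closureIdx L (collar X.1)) ≤ a236c L * treeLen X.1
  exact geometry236_centre hL X.2.2.1 X.2.2.2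

end

end Literature.MathematicalPhysics.QuantumFieldTheory.Balaban1983to89.B13Geometry236Printed
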